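import Literature.Algebra.Homology.KerZeroOfQuasiIso
import HarnessLib

/-!
# The isomorphism `Ker d⁰_P ≅ Ker d⁰_C` of a quasi-isomorphism is `ψ⁰` (explicit form)

`Literature/Algebra/Homology/KerZeroOfQuasiIso` records that a quasi-isomorphism `ψ : P → C` of
cochain complexes of modules concentrated in degrees `≥ 0` identifies `Ker(d⁰_P) ≅ Ker(d⁰_C)`, as a
`Nonempty` (enough for dimension counts). For the *base change maps* of the Grothendieck complex
(Görtz–Wedhorn II, (23.28.6): `β⁰(κ(s))` is induced by the comparison maps themselves, so one needs
to know WHICH isomorphism) this file makes the identification explicit: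
`kerZeroEquivOfQuasiIso ψ` is the restriction of `ψ⁰ : P⁰ → C⁰` to the kernels
(`coe_kerZeroEquivOfQuasiIso`), assembled from Mathlib's homology API exactly as in the existence
proof (`HomologicalComplex.isIso_homologyπ`, `homologyπ_naturality`, `cyclesMap_i`,
`ShortComplex.moduleCatCyclesIso_hom_i`). Nothing here is specific to schemes.

## References

* U. Görtz, T. Wedhorn, *Algebraic Geometry II: Cohomology of Schemes*, Springer Spektrum (2023),
  doi:10.1007/978-3-658-43031-3: proof of Prop. 23.117, p. 466; (23.28.6), p. 482.
  [GortzWedhorn2023]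
-/

universe v u

open CategoryTheory CategoryTheory.Limits HomologicalComplex

namespace Literature.Algebra.Homology

variable {S : Type u} [Ring S]

/-- `kerDEquivOfEq` is the identity on underlying elements. [folklore] -/
@[simp] theorem coe_kerDEquivOfEq (K : CochainComplex (ModuleCat.{v} S) ℤ) (i : ℤ) {j j' : ℤ}
    (e : j = j') (x : LinearMap.ker (K.d i j).hom) :
    (kerDEquivOfEq K i e x : K.X i) = x := by
  subst e
  rfl

/-- `cyclesZeroEquivKer` followed by the inclusion `Ker d⁰ ⊆ K⁰` is Mathlib's `iCycles`.
[folklore] -/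
@[simp] theorem coe_cyclesZeroEquivKer (K : CochainComplex (ModuleCat.{v} S) ℤ) (z : K.cycles 0) :
    (cyclesZeroEquivKer K z : K.X 0) = K.iCycles 0 z := by
  have h1 : ∀ {j j' : ℤ} (e : j = j') (y : LinearMap.ker (K.d 0 j).hom),
      ((kerDEquivOfEq K 0 e y : LinearMap.ker (K.d 0 j').hom) : K.X 0) = y := fun e y => by
    subst e; rfl
  have h2 := ShortComplex.moduleCatCyclesIso_hom_i_apply (K.sc 0) z
  exact (h1 (CochainComplex.next ℤ 0) ((K.sc 0).moduleCatCyclesIso.toLinearEquiv z)).trans h2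

/-- For a quasi-isomorphism of complexes concentrated in degrees `≥ 0` the induced map on
`0`-cycles is an isomorphism (`Z⁰ = H⁰` on both sides). [folklore] -/
theorem isIso_cyclesMap_zero_of_quasiIso {P C : CochainComplex (ModuleCat.{v} S) ℤ}
    (ψ : P ⟶ C) [QuasiIso ψ] [P.IsStrictlyGE 0] [C.IsStrictlyGE 0] : IsIso (cyclesMap ψ 0) := by
  have hP0 : P.d (-1) 0 = 0 := (P.isZero_of_isStrictlyGE 0 (-1) (by omega)).eq_of_src _ _
  have hC0 : C.d (-1) 0 = 0 := (C.isZero_of_isStrictlyGE 0 (-1) (by omega)).eq_of_src _ _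
  haveI := P.isIso_homologyπ (-1) 0 (by simp) hP0
  haveI := C.isIso_homologyπ (-1) 0 (by simp) hC0
  haveI : IsIso (homologyMap ψ 0) := by
    rw [← quasiIsoAt_iff_isIso_homologyMap]
    infer_instance
  have e : cyclesMap ψ 0 = P.homologyπ 0 ≫ homologyMap ψ 0 ≫ inv (C.homologyπ 0) := by
    rw [← Category.assoc, homologyπ_naturality, Category.assoc, IsIso.hom_inv_id,
      Category.comp_id]
  rw [e]
  infer_instance

/-- **The isomorphism `Ker(d⁰_P) ≅ Ker(d⁰_C)` induced by a quasi-isomorphism `ψ : P → C` of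
complexes of modules concentrated in degrees `≥ 0`** (explicit form of
`nonempty_linearEquiv_ker_of_quasiIso`): `Ker d⁰_P ≅ Z⁰(P) ⥲ Z⁰(C) ≅ Ker d⁰_C`. [folklore] -/
noncomputable def kerZeroEquivOfQuasiIso {P C : CochainComplex (ModuleCat.{v} S) ℤ}
    (ψ : P ⟶ C) [QuasiIso ψ] [P.IsStrictlyGE 0] [C.IsStrictlyGE 0] :
    LinearMap.ker (P.d 0 1).hom ≃ₗ[S] LinearMap.ker (C.d 0 1).hom :=
  haveI := isIso_cyclesMap_zero_of_quasiIso ψ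
  (cyclesZeroEquivKer P).symm.trans
    ((asIso (cyclesMap ψ 0)).toLinearEquiv.trans (cyclesZeroEquivKer C))

/-- **`kerZeroEquivOfQuasiIso ψ` is the restriction of `ψ⁰` to the kernels.** [folklore] -/
@[simp] theorem coe_kerZeroEquivOfQuasiIso {P C : CochainComplex (ModuleCat.{v} S) ℤ}
    (ψ : P ⟶ C) [QuasiIso ψ] [P.IsStrictlyGE 0] [C.IsStrictlyGE 0]
    (x : LinearMap.ker (P.d 0 1).hom) :
    (kerZeroEquivOfQuasiIso ψ x : C.X 0) = ψ.f 0 x := by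
  haveI := isIso_cyclesMap_zero_of_quasiIso ψ
  set z := (cyclesZeroEquivKer P).symm x with hz
  have hx : (x : P.X 0) = P.iCycles 0 z := by
    rw [← coe_cyclesZeroEquivKer, hz, LinearEquiv.apply_symm_apply]
  unfold kerZeroEquivOfQuasiIso
  rw [LinearEquiv.trans_apply, LinearEquiv.trans_apply, ← hz, coe_cyclesZeroEquivKer,
    Iso.toLinearEquiv_apply, asIso_hom, hx]
  exact ConcreteCategory.congr_hom (cyclesMap_i ψ 0) z

end Literature.Algebra.Homology
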